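import Literature.NumberTheory.ComplexMultiplication.PairKernelQuadraticSubfield
import Literature.NumberTheory.ComplexMultiplication.ReflexDegreeRankBounds
import HarnessLib

/-!
# The reflex degree of a CM type over an imaginary quadratic subfield: `[K′ : ℚ] ≤ C(n,a) + C(n,b)`
# (Dodson 1984, §3.1.1: "the `G`-orbit of `f` is `G₀*(f) ∪ G₀*(ρf)`"), and the Galois group at a block

B. Dodson, *The structure of Galois groups of CM-fields*, Trans. AMS **283** (1984) [Dodson1984] (held text
`paper:doi-10-2307-1999987`), §3.1.1 Theorem, proof (p. 12, L4–L10):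

> "Let `D` be an imaginary quadratic subfield of `K`.  Then `Kᶜ` is the composite `Kᶜ = DK₀ᶜ`, so that
> `[Kᶜ : K₀ᶜ] = 2`, i.e., `v = 1`. … The `ρ`-structure is then given by `s(σ)` identically `0`, so that **the
> `G`-orbit of `f` is `G₀*(f) ∪ G₀*(ρf)`**."

with §1.3 Remark (p. 5): "Note that `[K′ : ℚ]` is also the order of the orbit of `Φ` under the `G`-action", and
§3.1.0 (p. 11): "the weight of `f ∈ (ℤ₂)ⁿ` … will refer to the sum `f₁ + ⋯ + fₙ`".  In words: when the CM field `K`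
(`[K : ℚ] = 2n`) contains an imaginary quadratic field `D`, a CM type `Φ` of `K` is the datum of the subset
`f = E₀ ∖ Φ` of the block `E₀` (the `n` embeddings of `K` inducing a fixed embedding of `D`; `E₀` is itself a CM
type, with reflex field `D`), and the Galois translates of `Φ` are read on `E₀` as the `G₀ = Gal(Kᶜ/D)`-translates of
`f` (weight `|f| = b`) or of `ρf` (weight `n - b = a`, where `(a, b) = (|Φ ∩ E₀|, |E₀ ∖ Φ|)` are the multiplicities of
`Φ` over `D`).  Consequently

  **`[K′(Φ) : ℚ] = |G • Φ| ≤ C(n, a) + C(n, b)`, and `≤ C(n, a)` when `a = b`**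

(the translates inject into the `a`- and `b`-element subsets of the block).  This file proves that bound, at the
tree's group level (W) (`IsCMTypeWith ρ Φ`, a block `E₀` = a CM type with `gE₀ ∈ {E₀, ρE₀}` for all `g`, as in
`ConstantWeightCriterionQuadraticSubfield` / `PairKernelQuadraticSubfield`) and in the number-field dress (W_L)
(`K′ = reflexField ℚ L (algValuedIn ι Φ)`, the block given either as a CM type `Φ₀` with quadratic reflex field or as
the type induced from an imaginary quadratic field `k₀ → K`), together with the group-theoretic facts about the block
used by the sequel `DegenerateOcticCMTypesSexticReflex` (Dodson §3.3.2): `(G : G₀) = 2` for `G₀ = Stab(E₀)`, `G₀` acts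
faithfully and transitively on `E₀`, so `|G₀|` divides `n!` and is divisible by `n`; and `|G • Φ|` divides `|G|`.

PROVED, theorems only (no definition, no named fact; D-0014/D-0026).  Nothing here is specific to the Hodge
conjecture; `HC_CM` is neither used nor mentioned in the statements.

## Main statements

* group level, `h : IsCMTypeWith ρ Φ`, `h₀ : IsCMTypeWith ρ E₀`, `hG : ∀ g, g • E₀ = E₀ ∨ g • E₀ = ρ • E₀`:
  `IsCMTypeWith.eq_of_inter_eq` (a CM type is determined by its trace on the block),
  `IsCMTypeWith.exists_smul_set_inter_eq` (the trace of a translate `gΦ` on `E₀` is a `G₀`-translate of `Φ ∩ E₀` or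
  of `E₀ ∖ Φ` — Dodson's "`G₀*(f) ∪ G₀*(ρf)`"), **`IsCMTypeWith.card_orbit_le_choose_add_choose`**
  (`|G • Φ| ≤ C(n,a) + C(n,b)`), `IsCMTypeWith.card_orbit_le_two_mul_choose`, **`IsCMTypeWith.card_orbit_le_choose`**
  (`a = b ⟹ |G • Φ| ≤ C(n,a)`); `orbit_eq_pair_of_block`, `IsCMTypeWith.index_stabilizer_eq_two_of_block`,
  `IsCMTypeWith.card_eq_two_mul_card_stabilizer_of_block`, `IsCMTypeWith.faithfulSMul_stabilizer_of_block`,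
  `IsCMTypeWith.isPretransitive_stabilizer_of_block`, `IsCMTypeWith.card_stabilizer_dvd_factorial_of_block`,
  `IsCMTypeWith.ncard_dvd_card_stabilizer_of_block`, `card_orbit_dvd_card`.
* number fields (`K` a number field, `L/ℚ` Galois CM receiving `K` by `j`, `ι : L → ℂ`, `Φ : CMType K`):
  **`finrank_reflexField_le_choose_add_choose`** (block = a CM type `Φ₀` of `K` with `[K′(Φ₀) : ℚ] = 2`),
  `finrank_reflexField_le_choose` (balanced case), and the same for the type induced from an imaginary quadratic
  field `k : k₀ →+* K` (**`finrank_reflexField_le_choose_add_choose_of_ringHom`**, `finrank_reflexField_le_choose_of_ringHom`).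

## References

* [Dodson1984] B. Dodson, Trans. AMS 283 (1984) 1–32, §1.3 Remark (p. 5), §3.1.0–§3.1.1 (pp. 11–12).
* [Shimura1998] G. Shimura, *Abelian varieties with complex multiplication and modular functions*, §8.3 Prop. 28
  (`[K′ : ℚ] = [G : H′]`).
-/

set_option autoImplicit false

open scoped Pointwise

namespace Literature.NumberTheory.ComplexMultiplication

/-! ## Part I — group level -/

section GroupLevel

variable {G : Type*} [Group G] {E : Type*} [MulAction G E] {ρ : G} {Φ E₀ : Set E}

/-- Orbit–stabiliser: the number of translates of `Φ` divides `|G|` ("`(G : H′(Φ)) = |G|/|H′(Φ)|`").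
[cite: Dodson1984, §1.3 Reflex Degree Theorem (proof) and Remark] -/
theorem card_orbit_dvd_card (Φ : Set E) : Nat.card (MulAction.orbit G Φ) ∣ Nat.card G := by
  rw [Nat.card_coe_set_eq, ← MulAction.index_stabilizer]
  exact Subgroup.index_dvd_card _

namespace IsCMTypeWith

/-! ### A CM type is determined by its trace on a block -/

/-- `ρΦ = Φᶜ` for a CM type `Φ` (the type `Φ^{ρf}` is the complementary choice in every pair `{φ, φ̄}`).
[cite: Dodson1984, §1.2 Proposition] -/
theorem rho_smul_set_eq_compl (h : IsCMTypeWith ρ Φ) : ρ • Φ = Φᶜ := by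
  ext x
  rw [Set.mem_smul_set_iff_inv_smul_mem, Set.mem_compl_iff, inv_smul_eq_iff.2 (h.invol x).symm]
  exact h.rho_smul_mem_iff x

/-- Every translate of a CM type is a CM type (for the same `ρ`). [cite: Dodson1984, §1.2 Proposition] -/
theorem smul_set (h : IsCMTypeWith ρ Φ) (g : G) : IsCMTypeWith ρ (g • Φ) :=
  ⟨fun x => h.mem_smul_set_iff_rho_smul_notMem g x, h.comm, h.invol⟩

/-- **A CM type is determined by its trace on a block**: if two CM types `Ψ, Ψ′` (for the same `ρ`) meet a CM
type `E₀` in the same set, they are equal (for `x ∉ E₀`, `ρx ∈ E₀` and `x ∈ Ψ ↔ ρx ∉ Ψ`) — Dodson's "a CM-type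
`Φ` may be specified by giving `f ∈ (ℤ₂)ⁿ`". [cite: Dodson1984, §1.2 Proposition] -/
theorem eq_of_inter_eq {Ψ Ψ' : Set E} (hΨ : IsCMTypeWith ρ Ψ) (hΨ' : IsCMTypeWith ρ Ψ')
    (h₀ : IsCMTypeWith ρ E₀) (heq : Ψ ∩ E₀ = Ψ' ∩ E₀) : Ψ = Ψ' := by
  have key : ∀ y ∈ E₀, (y ∈ Ψ ↔ y ∈ Ψ') := fun y hy =>
    ⟨fun h1 => ((Set.ext_iff.1 heq y).1 ⟨h1, hy⟩).1, fun h1 => ((Set.ext_iff.1 heq y).2 ⟨h1, hy⟩).1⟩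
  ext x
  by_cases hx : x ∈ E₀
  · exact key x hx
  · rw [hΨ.mem_iff x, hΨ'.mem_iff x, key (ρ • x) ((h₀.rho_smul_mem_iff x).2 hx)]

/-! ### The trace of a translate: Dodson's `G₀*(f) ∪ G₀*(ρf)` -/

/-- `ρ⁻¹` acts as `ρ`. [folklore] -/
private theorem rho_inv_smul' (h₀ : IsCMTypeWith ρ E₀) (y : E) : ρ⁻¹ • y = ρ • y :=
  inv_smul_eq_iff.2 (h₀.invol y).symm

/-- `ρ⁻¹ • S = ρ • S` on sets. [folklore] -/
private theorem rho_inv_smul_set (h₀ : IsCMTypeWith ρ E₀) (S : Set E) : ρ⁻¹ • S = ρ • S := by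
  ext x
  rw [Set.mem_smul_set_iff_inv_smul_mem, inv_inv, Set.mem_smul_set_iff_inv_smul_mem, h₀.rho_inv_smul']

/-- **The trace of a translate on the block** ("the `G`-orbit of `f` is `G₀*(f) ∪ G₀*(ρf)`"): for every `g` there
is `m ∈ G₀ = Stab(E₀)` with `gΦ ∩ E₀ = m(Φ ∩ E₀)` (when `g ∈ G₀`, `m = g`) or `gΦ ∩ E₀ = m(E₀ ∖ Φ)` (when
`g ∈ ρG₀`, `m = ρg`). [cite: Dodson1984, §3.1.1 Theorem (proof)] -/
theorem exists_smul_set_inter_eq (h : IsCMTypeWith ρ Φ) (h₀ : IsCMTypeWith ρ E₀)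
    (hG : ∀ g : G, g • E₀ = E₀ ∨ g • E₀ = ρ • E₀) (g : G) :
    ∃ m ∈ MulAction.stabilizer G E₀, g • Φ ∩ E₀ = m • (Φ ∩ E₀) ∨ g • Φ ∩ E₀ = m • (E₀ \ Φ) := by
  rcases h₀.mem_stabilizer_or hG g with hg | hg
  · refine ⟨g, hg, Or.inl ?_⟩
    have hgE : g • E₀ = E₀ := hg
    rw [Set.smul_set_inter, hgE]
  · refine ⟨ρ * g, hg, Or.inr ?_⟩
    have hmE : (ρ * g) • E₀ = E₀ := hg
    have hg' : g = ρ⁻¹ * (ρ * g) := by group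
    -- `gΦ = ρ (mΦ) = (mΦ)ᶜ`
    have h1 : g • Φ = (((ρ * g) • Φ)ᶜ : Set E) := by
      conv_lhs => rw [hg', mul_smul, h₀.rho_inv_smul_set]
      exact (h.smul_set (ρ * g)).rho_smul_set_eq_compl
    rw [h1, Set.smul_set_sdiff, hmE, Set.sdiff_eq_compl_inter]

/-- Hence the trace of a translate has `a = |Φ ∩ E₀|` or `b = |E₀ ∖ Φ|` elements (the weight of a translate is the
weight of `f` or of `ρf`). [cite: Dodson1984, §3.1.1 Theorem (proof)] -/
theorem ncard_smul_set_inter_eq_or (h : IsCMTypeWith ρ Φ) (h₀ : IsCMTypeWith ρ E₀)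
    (hG : ∀ g : G, g • E₀ = E₀ ∨ g • E₀ = ρ • E₀) (g : G) :
    (g • Φ ∩ E₀).ncard = (Φ ∩ E₀).ncard ∨ (g • Φ ∩ E₀).ncard = (E₀ \ Φ).ncard := by
  obtain ⟨m, -, hm | hm⟩ := h.exists_smul_set_inter_eq h₀ hG g
  · exact Or.inl (by rw [hm, Set.ncard_smul_set])
  · exact Or.inr (by rw [hm, Set.ncard_smul_set])

/-! ### The orbit bound `|G • Φ| ≤ C(n,a) + C(n,b)` -/

/-- Core of the count: the translates of `Φ` inject, by their traces on `E₀`, into the `a`-subsets and the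
`b`-subsets of (a finset copy of) the block. [cite: Dodson1984, §3.1.1 Theorem (proof); §1.3 Remark] -/
private theorem card_orbit_le_card_union [Finite E] [DecidableEq E] (h : IsCMTypeWith ρ Φ)
    (h₀ : IsCMTypeWith ρ E₀) (hG : ∀ g : G, g • E₀ = E₀ ∨ g • E₀ = ρ • E₀) (E₀f : Finset E)
    (hE₀f : (E₀f : Set E) = E₀) :
    Nat.card (MulAction.orbit G Φ) ≤
      (E₀f.powersetCard (Φ ∩ E₀).ncard ∪ E₀f.powersetCard (E₀ \ Φ).ncard).card := by
  classical
  set T := E₀f.powersetCard (Φ ∩ E₀).ncard ∪ E₀f.powersetCard (E₀ \ Φ).ncard with hT_def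
  -- the trace of a member of the orbit, as a finset inside `E₀f`
  have htrace : ∀ Ψ : Set E, ((E₀f.filter fun x => x ∈ Ψ : Finset E) : Set E) = Ψ ∩ E₀ := fun Ψ => by
    ext x
    rw [Finset.coe_filter, Set.mem_setOf_eq, ← Finset.mem_coe, hE₀f, Set.mem_inter_iff, and_comm]
  have hcardtrace : ∀ Ψ : Set E, (E₀f.filter fun x => x ∈ Ψ).card = (Ψ ∩ E₀).ncard := fun Ψ => by
    rw [← htrace Ψ, Set.ncard_coe_finset]
  have hmem : ∀ Ψ : MulAction.orbit G Φ, (E₀f.filter fun x => x ∈ (Ψ : Set E)) ∈ T := by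
    rintro ⟨Ψ, g, rfl⟩
    rw [hT_def, Finset.mem_union, Finset.mem_powersetCard, Finset.mem_powersetCard, hcardtrace]
    rcases h.ncard_smul_set_inter_eq_or h₀ hG g with h1 | h1
    · exact Or.inl ⟨Finset.filter_subset _ _, h1⟩
    · exact Or.inr ⟨Finset.filter_subset _ _, h1⟩
  let f : MulAction.orbit G Φ → T := fun Ψ => ⟨E₀f.filter fun x => x ∈ (Ψ : Set E), hmem Ψ⟩
  have hf : Function.Injective f := by
    rintro ⟨Ψ, g, rfl⟩ ⟨Ψ', g', rfl⟩ hΨ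
    have h1 : (E₀f.filter fun x => x ∈ g • Φ) = E₀f.filter fun x => x ∈ g' • Φ := congrArg Subtype.val hΨ
    have h2 : g • Φ ∩ E₀ = g' • Φ ∩ E₀ := by
      rw [← htrace (g • Φ), ← htrace (g' • Φ), h1]
    exact Subtype.ext ((h.smul_set g).eq_of_inter_eq (h.smul_set g') h₀ h2)
  calc Nat.card (MulAction.orbit G Φ) ≤ Nat.card T := Nat.card_le_card_of_injective f hf
    _ = T.card := by rw [Nat.card_eq_fintype_card, Fintype.card_coe]

/-- **`|G • Φ| ≤ C(n,a) + C(n,b)`** for a CM type `Φ` with multiplicities `(a, b) = (|Φ ∩ E₀|, |E₀ ∖ Φ|)` over a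
block `E₀` of size `n` ("the `G`-orbit of `f` is `G₀*(f) ∪ G₀*(ρf)`", the two pieces having at most `C(n,|ρf|)`
and `C(n,|f|)` members; `[K′ : ℚ]` "is also the order of the orbit of `Φ`").
[cite: Dodson1984, §3.1.1 Theorem (proof); §1.3 Remark] -/
theorem card_orbit_le_choose_add_choose [Finite E] (h : IsCMTypeWith ρ Φ) (h₀ : IsCMTypeWith ρ E₀)
    (hG : ∀ g : G, g • E₀ = E₀ ∨ g • E₀ = ρ • E₀) :
    Nat.card (MulAction.orbit G Φ) ≤
      (E₀.ncard).choose (Φ ∩ E₀).ncard + (E₀.ncard).choose (E₀ \ Φ).ncard := by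
  classical
  obtain ⟨E₀f, hE₀f⟩ := (Set.toFinite E₀).exists_finset_coe
  refine (h.card_orbit_le_card_union h₀ hG E₀f hE₀f).trans ((Finset.card_union_le _ _).trans ?_)
  rw [Finset.card_powersetCard, Finset.card_powersetCard, ← hE₀f, Set.ncard_coe_finset]

/-- `a + b = n`. [folklore] -/
private theorem ncard_inter_add_ncard_diff [Finite E] (Φ E₀ : Set E) :
    (Φ ∩ E₀).ncard + (E₀ \ Φ).ncard = E₀.ncard := by
  rw [Set.inter_comm]
  exact Set.ncard_inter_add_ncard_sdiff_eq_ncard E₀ Φ (Set.toFinite E₀)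

/-- **`|G • Φ| ≤ 2·C(n,a)`** (as `C(n,b) = C(n,n-a) = C(n,a)`). [cite: Dodson1984, §3.1.1 Theorem (proof)] -/
theorem card_orbit_le_two_mul_choose [Finite E] (h : IsCMTypeWith ρ Φ) (h₀ : IsCMTypeWith ρ E₀)
    (hG : ∀ g : G, g • E₀ = E₀ ∨ g • E₀ = ρ • E₀) :
    Nat.card (MulAction.orbit G Φ) ≤ 2 * (E₀.ncard).choose (Φ ∩ E₀).ncard := by
  have h1 := h.card_orbit_le_choose_add_choose h₀ hG
  have h2 := ncard_inter_add_ncard_diff Φ E₀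
  have h3 : (E₀.ncard).choose (E₀ \ Φ).ncard = (E₀.ncard).choose (Φ ∩ E₀).ncard := by
    rw [show (E₀ \ Φ).ncard = E₀.ncard - (Φ ∩ E₀).ncard by omega, Nat.choose_symm (by omega)]
  omega

/-- **Balanced case `a = b`: `|G • Φ| ≤ C(n,a)`** — the translates of a type with equal multiplicities over the
block all have weight `a = n/2`, so they inject into the `a`-subsets of the block.
[cite: Dodson1984, §3.1.1 Theorem (proof)] -/
theorem card_orbit_le_choose [Finite E] (h : IsCMTypeWith ρ Φ) (h₀ : IsCMTypeWith ρ E₀)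
    (hG : ∀ g : G, g • E₀ = E₀ ∨ g • E₀ = ρ • E₀) (hbal : (Φ ∩ E₀).ncard = (E₀ \ Φ).ncard) :
    Nat.card (MulAction.orbit G Φ) ≤ (E₀.ncard).choose (Φ ∩ E₀).ncard := by
  classical
  obtain ⟨E₀f, hE₀f⟩ := (Set.toFinite E₀).exists_finset_coe
  have h1 := h.card_orbit_le_card_union h₀ hG E₀f hE₀f
  rw [← hbal, Finset.union_idempotent, Finset.card_powersetCard, ← Set.ncard_coe_finset E₀f, hE₀f] at h1
  exact h1

/-! ### The block and its stabiliser `G₀`: index `2`, faithful and transitive on the block -/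

/-- `ρE₀ ≠ E₀` for a CM type `E₀` (on a nonempty `E`): the block has exactly "two types having `D` as a reflex
field". [cite: Dodson1984, §3.1.1 Theorem (proof)] -/
theorem rho_smul_set_ne [Nonempty E] (h₀ : IsCMTypeWith ρ E₀) : ρ • E₀ ≠ E₀ := by
  obtain ⟨x⟩ := ‹Nonempty E›
  rw [h₀.rho_smul_set_eq_compl]
  intro heq
  by_cases hx : x ∈ E₀
  · have : x ∈ E₀ᶜ := heq.symm ▸ hx
    exact this hx
  · exact hx (heq ▸ (Set.mem_compl hx))

/-- The orbit of a block is `{E₀, ρE₀}`. [cite: Dodson1984, §3.1.1 Theorem (proof)] -/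
theorem _root_.Literature.NumberTheory.ComplexMultiplication.orbit_eq_pair_of_block
    (hG : ∀ g : G, g • E₀ = E₀ ∨ g • E₀ = ρ • E₀) : MulAction.orbit G E₀ = {E₀, ρ • E₀} := by
  ext S
  simp only [Set.mem_insert_iff, Set.mem_singleton_iff]
  constructor
  · rintro ⟨g, rfl⟩
    exact hG g
  · rintro (hS | hS) <;> rw [hS]
    exacts [MulAction.mem_orbit_self E₀, MulAction.mem_orbit E₀ ρ]

/-- **`(G : G₀) = 2`** for `G₀ = Stab(E₀)` ("`⟨ρ⟩ × G₀`"). [cite: Dodson1984, §3.1.1 Theorem] -/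
theorem index_stabilizer_eq_two_of_block [Nonempty E] (h₀ : IsCMTypeWith ρ E₀)
    (hG : ∀ g : G, g • E₀ = E₀ ∨ g • E₀ = ρ • E₀) : (MulAction.stabilizer G E₀).index = 2 := by
  rw [MulAction.index_stabilizer, orbit_eq_pair_of_block hG, Set.ncard_pair h₀.rho_smul_set_ne.symm]

/-- **`|G| = 2|G₀|`**. [cite: Dodson1984, §3.1.1 Theorem] -/
theorem card_eq_two_mul_card_stabilizer_of_block [Nonempty E] (h₀ : IsCMTypeWith ρ E₀)
    (hG : ∀ g : G, g • E₀ = E₀ ∨ g • E₀ = ρ • E₀) :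
    Nat.card G = 2 * Nat.card (MulAction.stabilizer G E₀) := by
  rw [← (MulAction.stabilizer G E₀).index_mul_card, h₀.index_stabilizer_eq_two_of_block hG]

/-- **`G₀` acts faithfully on the block** when `G` acts faithfully on `E` (an element fixing `E₀` pointwise fixes
`ρE₀` pointwise, as `gρx = ρgx`): `G₀ = Gal(Kᶜ/D) ≅ Gal(K₀ᶜ/ℚ)` "is given as a transitive permutation group of
degree `n`". [cite: Dodson1984, §1.1 Imprimitivity Theorem (1)] -/
theorem faithfulSMul_stabilizer_of_block [FaithfulSMul G E] (h₀ : IsCMTypeWith ρ E₀) :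
    FaithfulSMul (MulAction.stabilizer G E₀) E₀ := by
  refine ⟨fun {m m'} hmm' => Subtype.ext (eq_of_smul_eq_smul (α := E) fun x => ?_)⟩
  have key : ∀ y ∈ E₀, (m : G) • y = (m' : G) • y := fun y hy => by
    have := congrArg Subtype.val (hmm' ⟨y, hy⟩)
    rwa [SMul.smul_stabilizer_def, SMul.smul_stabilizer_def] at this
  by_cases hx : x ∈ E₀
  · exact key x hx
  · have h1 := key (ρ • x) ((h₀.rho_smul_mem_iff x).2 hx)
    rw [h₀.comm, h₀.comm] at h1
    have h2 := congrArg (fun y => ρ • y) h1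
    simpa only [h₀.invol] using h2

/-- **`G₀` is transitive on the block** (as `G` is transitive on `E` and `gE₀ ∈ {E₀, ρE₀}`).
[cite: Dodson1984, §1.1 Imprimitivity Theorem (1)] -/
theorem isPretransitive_stabilizer_of_block [MulAction.IsPretransitive G E] (h₀ : IsCMTypeWith ρ E₀)
    (hG : ∀ g : G, g • E₀ = E₀ ∨ g • E₀ = ρ • E₀) :
    MulAction.IsPretransitive (MulAction.stabilizer G E₀) E₀ := by
  refine ⟨fun x y => ?_⟩
  obtain ⟨g, hg⟩ := MulAction.exists_smul_eq G (x : E) (y : E)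
  have hgE : g • E₀ = E₀ := by
    rcases hG g with h1 | h1
    · exact h1
    · exfalso
      have hgx : g • (x : E) ∈ ρ • E₀ := by
        rw [← h1]
        exact Set.smul_mem_smul_set x.2
      rw [hg] at hgx
      obtain ⟨z, hz, hzy⟩ := hgx
      have hzy' : ρ • z = y := hzy
      exact (h₀.mem_iff z).1 hz (hzy' ▸ y.2)
  exact ⟨⟨g, hgE⟩, Subtype.ext (by rw [SMul.smul_stabilizer_def]; exact hg)⟩

/-- **`|G₀|` divides `n!`** (`G₀ ↪ Sym(E₀)`), for a faithful action. [cite: Dodson1984, §1.1 Imprimitivity Theorem (1)] -/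
theorem card_stabilizer_dvd_factorial_of_block [FaithfulSMul G E] [Finite E] (h₀ : IsCMTypeWith ρ E₀) :
    Nat.card (MulAction.stabilizer G E₀) ∣ (E₀.ncard).factorial := by
  classical
  haveI : Fintype E := Fintype.ofFinite E
  haveI := h₀.faithfulSMul_stabilizer_of_block
  have hinj : Function.Injective (MulAction.toPermHom (MulAction.stabilizer G E₀) E₀) := MulAction.toPerm_injective
  haveI : Finite (MulAction.stabilizer G E₀) := Finite.of_injective _ hinj
  have h1 : Nat.card (MulAction.stabilizer G E₀) =
      Nat.card (MulAction.toPermHom (MulAction.stabilizer G E₀) E₀).range :=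
    Nat.card_congr (MonoidHom.ofInjective hinj).toEquiv
  rw [h1, ← Nat.card_coe_set_eq E₀, ← Nat.card_perm]
  exact Subgroup.card_subgroup_dvd_card _

/-- **`n` divides `|G₀|`** (transitivity on the block), for `G` finite. [cite: Dodson1984, §1.1 Imprimitivity Theorem (1)] -/
theorem ncard_dvd_card_stabilizer_of_block [MulAction.IsPretransitive G E] [Finite G] (hne : E₀.Nonempty)
    (h₀ : IsCMTypeWith ρ E₀) (hG : ∀ g : G, g • E₀ = E₀ ∨ g • E₀ = ρ • E₀) :
    E₀.ncard ∣ Nat.card (MulAction.stabilizer G E₀) := by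
  haveI := h₀.isPretransitive_stabilizer_of_block hG
  obtain ⟨x, hx⟩ := hne
  rw [← Nat.card_coe_set_eq E₀,
    ← MulAction.index_stabilizer_of_transitive (MulAction.stabilizer G E₀) (⟨x, hx⟩ : E₀)]
  exact Subgroup.index_dvd_card _

end IsCMTypeWith

end GroupLevel

/-! ## Part II — number fields: the reflex degree of a type over an imaginary quadratic subfield -/

section NumberField

open NumberField
open Literature.AlgebraicGeometry.Motives (CMType)

variable {K : Type} [Field K] [NumberField K]
variable {L : Type} [Field L] [NumberField L] [IsCMField L] [IsGalois ℚ L]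

omit [IsCMField L] [IsGalois ℚ L] in
/-- `algValuedIn` commutes with `∩`. [folklore] -/
private theorem algValuedIn_inter (ι : L →+* ℂ) (Ψ Ψ' : Set (K →+* ℂ)) :
    algValuedIn ι (Ψ ∩ Ψ') = algValuedIn ι Ψ ∩ algValuedIn ι Ψ' := rfl

omit [IsCMField L] [IsGalois ℚ L] in
/-- `algValuedIn` commutes with `∖`. [folklore] -/
private theorem algValuedIn_diff (ι : L →+* ℂ) (Ψ Ψ' : Set (K →+* ℂ)) :
    algValuedIn ι (Ψ \ Ψ') = algValuedIn ι Ψ \ algValuedIn ι Ψ' := rfl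

/-- A CM type has `n = [K : ℚ]/2` members ("a CM-type `(K, Φ)` specifies a set `Φ = {φ₁, …, φₙ}` of `n`
embeddings of `K` into `ℂ`", `[K : ℚ] = 2n`). [cite: Dodson1984, Introduction (p. 1)] -/
theorem ncard_cmType_eq (Φ : CMType K) : Φ.1.ncard = Module.finrank ℚ K / 2 := by
  have := Literature.AlgebraicGeometry.Motives.HodgeStructure.two_mul_ncard_cmType_eq_finrank Φ
  omega

/-- A CM type `Φ₀` of `K` with QUADRATIC reflex field is a block: every Galois element maps it onto itself or
onto its conjugate ("`K` has two types having `D` as a reflex field of degree `2`").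
[cite: Dodson1984, §3.1.1 Theorem (proof)] -/
theorem smul_algValuedIn_eq_or_of_finrank_reflexField_eq_two (j : K →ₐ[ℚ] L) (ι : L →+* ℂ) (Φ₀ : CMType K)
    (h2 : Module.finrank ℚ (reflexField ℚ L (algValuedIn ι Φ₀.1)) = 2) (g : L ≃ₐ[ℚ] L) :
    g • algValuedIn ι Φ₀.1 = algValuedIn ι Φ₀.1 ∨
      g • algValuedIn ι Φ₀.1 = (conjGal : L ≃ₐ[ℚ] L) • algValuedIn ι Φ₀.1 := by
  haveI : Nonempty (K →ₐ[ℚ] L) := ⟨j⟩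
  have horb : (MulAction.orbit (L ≃ₐ[ℚ] L) (algValuedIn ι Φ₀.1)).ncard = 2 := by
    rw [← Nat.card_coe_set_eq, ← finrank_reflexField_eq_card_orbit, h2]
  exact (isCMTypeWith_conjGal_algValuedIn ι Φ₀).smul_eq_or_of_ncard_orbit_eq_two horb g

/-- **`[K′(Φ) : ℚ] ≤ C(n,a) + C(n,b)`** for a CM type `Φ` of a number field `K` (`2n = [K : ℚ]`) with
multiplicities `(a, b) = (|Φ ∩ Φ₀|, |Φ₀ ∖ Φ|)` over a block `Φ₀` — a CM type of `K` whose reflex field is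
(imaginary) quadratic, i.e. the type induced from an imaginary quadratic subfield `D`; `K′(Φ)` the reflex field
read in any Galois CM field `L ⊇ K`. [cite: Dodson1984, §3.1.1 Theorem (proof); §1.3 Remark] -/
theorem finrank_reflexField_le_choose_add_choose (j : K →ₐ[ℚ] L) (ι : L →+* ℂ) (Φ₀ Φ : CMType K)
    (h2 : Module.finrank ℚ (reflexField ℚ L (algValuedIn ι Φ₀.1)) = 2) :
    Module.finrank ℚ (reflexField ℚ L (algValuedIn ι Φ.1)) ≤
      (Module.finrank ℚ K / 2).choose (Φ.1 ∩ Φ₀.1).ncard +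
        (Module.finrank ℚ K / 2).choose (Φ₀.1 \ Φ.1).ncard := by
  haveI : Nonempty (K →ₐ[ℚ] L) := ⟨j⟩
  have h₀ := isCMTypeWith_conjGal_algValuedIn ι Φ₀
  have h := isCMTypeWith_conjGal_algValuedIn ι Φ
  have hG := smul_algValuedIn_eq_or_of_finrank_reflexField_eq_two j ι Φ₀ h2
  have key := h.card_orbit_le_choose_add_choose h₀ hG
  rw [← algValuedIn_inter, ← algValuedIn_diff, ncard_algValuedIn j ι, ncard_algValuedIn j ι,
    ncard_algValuedIn j ι, ncard_cmType_eq] at key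
  rwa [finrank_reflexField_eq_card_orbit]

/-- **Balanced case: `[K′(Φ) : ℚ] ≤ C(n, n/2)`** when `Φ` has equal multiplicities over the block `Φ₀`.
[cite: Dodson1984, §3.1.1 Theorem (proof); §1.3 Remark] -/
theorem finrank_reflexField_le_choose (j : K →ₐ[ℚ] L) (ι : L →+* ℂ) (Φ₀ Φ : CMType K)
    (h2 : Module.finrank ℚ (reflexField ℚ L (algValuedIn ι Φ₀.1)) = 2)
    (hbal : (Φ.1 ∩ Φ₀.1).ncard = (Φ₀.1 \ Φ.1).ncard) :
    Module.finrank ℚ (reflexField ℚ L (algValuedIn ι Φ.1)) ≤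
      (Module.finrank ℚ K / 2).choose (Φ.1 ∩ Φ₀.1).ncard := by
  haveI : Nonempty (K →ₐ[ℚ] L) := ⟨j⟩
  have h₀ := isCMTypeWith_conjGal_algValuedIn ι Φ₀
  have h := isCMTypeWith_conjGal_algValuedIn ι Φ
  have hG := smul_algValuedIn_eq_or_of_finrank_reflexField_eq_two j ι Φ₀ h2
  have hbal' : (algValuedIn ι Φ.1 ∩ algValuedIn ι Φ₀.1).ncard = (algValuedIn ι Φ₀.1 \ algValuedIn ι Φ.1).ncard := by
    rw [← algValuedIn_inter, ← algValuedIn_diff, ncard_algValuedIn j ι, ncard_algValuedIn j ι, hbal]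
  have key := h.card_orbit_le_choose h₀ hG hbal'
  rw [← algValuedIn_inter, ncard_algValuedIn j ι, ncard_algValuedIn j ι, ncard_cmType_eq] at key
  rwa [finrank_reflexField_eq_card_orbit]

section ImaginaryQuadratic

variable {k₀ : Type} [Field k₀] [NumberField k₀] [IsTotallyComplex k₀]

/-- **`[K′(Φ) : ℚ] ≤ C(n,a) + C(n,b)` for a CM field containing an imaginary quadratic field `k₀`** (embedded by
`k : k₀ →+* K`), `(a, b)` the multiplicities of `Φ` over the embedding `φ₀` of `k₀`: `a = |{φ ∈ Φ | φ ∘ k = φ₀}|`,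
`b = |{φ ∉ Φ | φ ∘ k = φ₀}|` (the block is the type induced from `(k₀, {φ₀})`, of reflex degree `2`).
[cite: Dodson1984, §3.1.1 Theorem (proof); §1.3 Remark] -/
theorem finrank_reflexField_le_choose_add_choose_of_ringHom (h2 : Module.finrank ℚ k₀ = 2) (k : k₀ →+* K)
    (j : K →ₐ[ℚ] L) (ι : L →+* ℂ) (φ₀ : k₀ →+* ℂ) (Φ : CMType K) :
    Module.finrank ℚ (reflexField ℚ L (algValuedIn ι Φ.1)) ≤
      (Module.finrank ℚ K / 2).choose {φ : K →+* ℂ | φ ∈ Φ.1 ∧ φ.comp k = φ₀}.ncard +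
        (Module.finrank ℚ K / 2).choose {φ : K →+* ℂ | φ ∉ Φ.1 ∧ φ.comp k = φ₀}.ncard := by
  have key := finrank_reflexField_le_choose_add_choose j ι (inducedCMType k (CMTypeCount.single h2 φ₀)) Φ
    (finrank_reflexField_algValuedIn_inducedCMType_single h2 k j ι φ₀)
  have h1 : Φ.1 ∩ (inducedCMType k (CMTypeCount.single h2 φ₀)).1 = {φ : K →+* ℂ | φ ∈ Φ.1 ∧ φ.comp k = φ₀} := by
    ext φ
    simp [mem_inducedCMType_iff, CMTypeCount.single_val]
  have h2' : (inducedCMType k (CMTypeCount.single h2 φ₀)).1 \ Φ.1 = {φ : K →+* ℂ | φ ∉ Φ.1 ∧ φ.comp k = φ₀} := by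
    ext φ
    simp only [Set.mem_sdiff, mem_inducedCMType_iff, CMTypeCount.single_val, Set.mem_singleton_iff,
      Set.mem_setOf_eq]
    tauto
  rwa [h1, h2'] at key

/-- **Balanced case over an imaginary quadratic subfield: `[K′(Φ) : ℚ] ≤ C(n, n/2)`** when `Φ` has multiplicities
`(n/2, n/2)` over `φ₀`. [cite: Dodson1984, §3.1.1 Theorem (proof); §1.3 Remark] -/
theorem finrank_reflexField_le_choose_of_ringHom (h2 : Module.finrank ℚ k₀ = 2) (k : k₀ →+* K)
    (j : K →ₐ[ℚ] L) (ι : L →+* ℂ) (φ₀ : k₀ →+* ℂ) (Φ : CMType K)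
    (hbal : {φ : K →+* ℂ | φ ∈ Φ.1 ∧ φ.comp k = φ₀}.ncard = {φ : K →+* ℂ | φ ∉ Φ.1 ∧ φ.comp k = φ₀}.ncard) :
    Module.finrank ℚ (reflexField ℚ L (algValuedIn ι Φ.1)) ≤
      (Module.finrank ℚ K / 2).choose {φ : K →+* ℂ | φ ∈ Φ.1 ∧ φ.comp k = φ₀}.ncard := by
  have h1 : Φ.1 ∩ (inducedCMType k (CMTypeCount.single h2 φ₀)).1 = {φ : K →+* ℂ | φ ∈ Φ.1 ∧ φ.comp k = φ₀} := by
    ext φ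
    simp [mem_inducedCMType_iff, CMTypeCount.single_val]
  have h2' : (inducedCMType k (CMTypeCount.single h2 φ₀)).1 \ Φ.1 = {φ : K →+* ℂ | φ ∉ Φ.1 ∧ φ.comp k = φ₀} := by
    ext φ
    simp only [Set.mem_sdiff, mem_inducedCMType_iff, CMTypeCount.single_val, Set.mem_singleton_iff,
      Set.mem_setOf_eq]
    tauto
  have key := finrank_reflexField_le_choose j ι (inducedCMType k (CMTypeCount.single h2 φ₀)) Φ
    (finrank_reflexField_algValuedIn_inducedCMType_single h2 k j ι φ₀) (by rw [h1, h2', hbal])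
  rwa [h1] at key

end ImaginaryQuadratic

end NumberField

end Literature.NumberTheory.ComplexMultiplication
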